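import Literature.MathematicalPhysics.QuantumFieldTheory.Balaban1983to89.Node00.OpsYSectE

/-!
# [B9] NODE 00 — the v4 INSTANCE OF RECORD: the SYMMETRISED site transporter `U(Γ_{z,w}) = U(Γ_{w,z})⁻¹` (located item R7) and the whole
letter chain of record re-issued over it (`G′, R, X, (Q′G′²Q′*)⁻¹, Δ_a, G, G(Ω′), Sect. D, (3.49), Sect. E ∕ C^{(k)}`)

Ninth file of the `pub-ymgap-node00-def-Y` lineage (cell `pub-ymgap`, HUMAN RULING D-0062, Track A node N06 [B9]; deprecate-and-add per the
director's LINE №138: no landed body is changed).  Print, [B9] = Balaban, *Propagators for lattice gauge theories in a background field*, CMP 99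
(1985), pp. 393–394 [PDF 5–6]:

* (3.19) «(Q′_j(U)λ)(y) = Σ_{x ∈ B^j(y)} L^{−jd} R(U(Γ^{(j)}_{y,x})) λ(x), y ∈ T^{(j)}_η» — ONE contour `Γ_{y,x}` from the block's reference point `y`
  to the site `x` («The contours Γ^{(j)}_{y,x}, x ∈ B_j(y), and the contour variables U(Γ^{(j)}_{y,x}) were defined by (52), (53) in [5]»);
* (3.24) «Let us introduce the operator Δ′_a = Δ′_a(U) = (Δ^η_U + Q′*aQ′)|_{Ω₀}, where Q′*aQ′ is defined by the same quadratic form as in (2.14),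
  i.e. ⟨λ, Q′*aQ′λ⟩ = Σ_j a_j Σ_{y ∈ Λ_j} (L^jη)^{d−2} |(Q′_j(U)λ)(y)|²» — a QUADRATIC FORM: `Q′*` is the ADJOINT of `Q′`, so the kernel of the
  averaging term between two sites `z, w` of one block with reference point `c` is `R(U(Γ_{c,z}))* R(U(Γ_{c,w})) = R(U(Γ_{c,z})⁻¹ · U(Γ_{c,w}))`
  (`R` unitary), and p. 416: «It is a symmetric and invertible operator».

LOCATED ITEM R7 (dag-n06-j g6, pub-ymgap bus 2026-08-27T04:27Z, confirmed by this seat).  FILE 3 `OpsYDeltaPrimeA.avgTrY par U z w := par U z c *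
par U c w` (`c` = the corner of the block of `z`) transports the averaged value BACK to `z` along `par U z c = U(Γ_{z,c})`; at the letters of record
(`parS := parSY`, FILE 2's axis-ordered taxicab contours) `U(Γ_{z,c})` is NOT `U(Γ_{c,z})⁻¹` — the two axis-ordered paths `z → c` and `c → z` bound a
rectangle, `U(Γ_{z,c})·U(Γ_{c,z})` is its holonomy, `≠ 1` for a non-flat `U` allowed by (3.35) — so `deltaPrimeAY parSY U`, and downstream `GpY, RY,
XY, XinvY, CY, deltaAY, GAY, GAv2Y, GAsndY`, the Sect. D letters and FILE 8's Sect. E assembly AT THE RECORD are print's operators only up to that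
O(α₀) holonomy, and `Δ′_a(U)` there is not a symmetric operator (row 17's printed inputs `symm0 ∕ symmG` of dag-n06-j's `Inputs311Y` are then not
dischargeable for `U ≠ 1`).  Every LANDED statement stays true (all certified faces are `U = 1` faces, where every transporter is `1`).

THE REPAIR (design (S), this file).  Not the operators — they are all GENERIC in the transporter letter `par` — but the LETTER OF RECORD is
replaced: the symmetrised site transporter
  `parSymY i U z w := if toLex z.1 ≤ toLex w.1 then parSY i U z w else (parSY i U w z)⁻¹`
(lexicographic order of the box-chart coordinates) is INVERSE-SYMMETRIC, `parSymY U w z = (parSymY U z w)⁻¹` (`parSymY_swap`) — print's tacit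
convention `U(Γ_{w,z}) = U(Γ_{z,w})⁻¹` for the reversed contour; it is `1` at `U = 1`, `G`-valued for `G`-valued `U`, and obeys FILE 6's contour gauge
law (`parSymY_isGaugeLawS`), so EVERY covariance theorem of FILES 6–7 (generic in `parS` + `IsGaugeLawS`) applies verbatim.  Since the block corner
`c` is coordinatewise `≤` every site it is the corner of (`cornerY_le`), `parSymY U c w = parSY U c w` on the leg INTO the block (`parSymY_cornerY`:
`Q′_j(U) = QpY` reads print's (3.19) contour unchanged) and `parSymY U z c = (parSY U c z)⁻¹` (`parSymY_cornerY'`), whence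
  `avgTrY (parSymY) U z w = U(Γ_{c,z})⁻¹ · parSymY U c w`            (`avgTrY_parSymY`; on-block `= U(Γ_{c,z})⁻¹·U(Γ_{c,w})`, `avgTrY_parSymY_of_corner_eq`)
— EXACTLY (3.24)'s adjoint pair — and the averaging kernel is inverse-symmetric on blocks, `avgTrY (parSymY) U w z = (avgTrY (parSymY) U z w)⁻¹`
(`avgTrY_parSymY_swap`), the face from which dag-n06-j discharges `IsSymmTr` of `Δ′_a(U)` at the v4 record for `SU(N)`-valued `U` (their module; this
file imports nothing of `B9Thm311*`).

WHAT IS DEFINED (namespace `…Balaban1983to89.Node00`; imports FILE 8 `Node00.OpsYSectE` only, hence FILES 1–7, `B9Eq3132SectDLetters` and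
`B9Ineq349SiteReading`; nothing restated):
* §1 `parSymY` + `parSymY_of_le ∕ _of_not_le ∕ _self ∕ _swap ∕ _inv_symm ∕ _mul_swap ∕ _one ∕ _mem ∕ _isGaugeLawS`, `cornerY_le`, `toLex_cornerY_le`,
  `parSymY_cornerY ∕ _cornerY'`, ★ `avgTrY_parSymY ∕ _of_corner_eq ∕ _swap`, `deltaPrimeAY_parSymY_apply`;
* §2 the v4 CHAIN at a member (one-liners over the landed generic updaters): `CovLettersY.withTransportS` (`parS := parSymY`, `parB := parBY`),
  `covLettersY_TGpS`, ★ `covLettersY_v2S := ((flat.withTransportS).withGp).withGAC` (+ `rfl` field lemmas, pins), `GAv4Y i := GAY i (parSymY i) (parBY i)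
  (GpY i (parSymY i))`, `GAsndSY x := GAv4Y x.snd`, `KdiffSY`, `KdiffSY_diag`, ★★ `covLettersY_v4 𝔯 := withSectD ((covLettersY_v2S).withDE (GAsndSY) 𝔯)`
  + fifteen `rfl` field lemmas + `covLettersY_v4_QGQinv_QG1Qinv_ringInverse`;
* §3 GAUGE COVARIANCE of the chain: `GAv4Y_isCovBondOpY`, `GAsndSY_isCovBondOpY`, `KdiffSY_cov`, `covLettersY_v2S_{Gp,C,GA}_cov`, ★ `covLettersY_v4_cov`;
* §4 AT THE RECORD (`𝔸 = M_N(ℂ)`, units `SU(N)`): ★ `lettersYOfRecordV4 N θ M⋆ 𝔯`, `opsYOfRecordV4 𝔯 𝔈 := opsYOfLetters … (lettersYOfRecordV4 …) 𝔈`,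
  `opsYS349OfRecordV4 𝔯 𝔈 := opsYS349OfLetters …` (dag-n06-i's generic (3.49) constructor, by name), ★★★ **`opsYOfRecordV4E N θ M⋆ 𝔯 𝔢 𝔴 𝔈 :=
  opsYSectE … (opsYS349OfRecordV4 …) (lettersYOfRecordV4 …) 𝔢 𝔴`** = THE v4 INSTANCE OF RECORD (symmetrised transporters; `G′, Δ_a⁻¹, (Q′G′²Q′*)⁻¹`;
  `G(Ω′)`, Thm 3.14's `Kdiff`; Sect. D's `G̃, (QG̃Q*)⁻¹, H, G₁, H₁, (QG₁Q*)⁻¹, 𝔊`; the genuine (3.49) reading in `P349`; `C^{(k)}(Λ;U)` (3.156)–(3.158) with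
  the (3.185) ∕ expansion slots) with the `rfl` transport family `lettersYOfRecordV4_*` (`_apply _parS _parB _sectB _pins _sectDE`), `opsYOfRecordV4E_*` (`_apply _Ck _Ck_ker _GivenBy3185 _HasRWExpC
  _P349 _P349_eq _letters _exps _Ck_ker_flat`), `Y9OfRecord_opsYOfRecordV4{,E}`, the named row-24 binder `t315_opsYOfRecordV4E_iff` + its honesty guard
  `t315_opsYOfRecordV4E_flat`, `lettersYOfRecordV4_cov ∕ _sectB_cov`, and the R7 face at the record `lettersYOfRecordV4_avgTr_swap`.

STATUS OF THE OLDER INSTANCES.  `lettersYOfRecord ∕ opsYOfRecord` (v2), `lettersYOfRecordDE ∕ opsYOfRecordDE` (v3), `opsYS349OfRecordDE`,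
`opsYOfRecordE ∕ opsYOfRecordES` STAY in the tree unchanged (append-only): they are the TAXICAB-transporter variants — every certified `U = 1` face of
theirs is true and every N06 certificate built on them is sound as displayed; for `U ≠ 1` they differ from print by the R7 holonomy.  THE INSTANCE OF
RECORD FROM THIS FILE ON is `opsYOfRecordV4E`; consumers re-point by the `rfl` family above (rows ≠ 24∕25: `opsYOfRecordV4E_letters ∕ _exps`; row 25:
`_P349_eq`; row 24: `t315_opsYOfRecordV4E_iff`).

HONEST SCOPE.  Finite-dimensional algebra and bookkeeping over landed definitions; `sorry`-free; no `instance`, no new syntax.  Nothing of [B9] is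
asserted: no estimate ((3.37)–(3.187)), no positivity, no expansion is proved; the Sect. E letters `𝔢`, the walk letters `𝔴`, the residual `Δ⁽²⁾` family
`𝔯` and the predicate ∕ expansion letters `𝔈` remain PARAMETERS exactly as in FILES 7–8 (located (O2′)∕(O2″)∕(O3) of the lineage's HANDOFF).  The
symmetrisation uses the lexicographic order of box coordinates — a DICTIONARY choice (print fixes one contour per unordered pair tacitly); on every leg
`corner → site` it coincides with FILE 2's taxicab contour.  NOT a node discharge, NOT summit progress; count-neutral; nothing continuum, OS, gap, Clay.

[cite: Balaban1985BackgroundPropagators, (3.19) p.393, (3.24) p.394, (3.25)–(3.27) p.395, (3.40) p.397, (3.48)–(3.49) pp.398–399, p.416, (3.122)–(3.132)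
pp.420–422, Thm 3.14 pp.426–427, (3.156)–(3.158) p.428, (3.185)–(3.187) p.432; Balaban1984PropagatorsII, (2.13)–(2.14) p.225]
-/

namespace Literature.MathematicalPhysics.QuantumFieldTheory.Balaban1983to89.Node00

open B4Reflection242 (blk)
open B6KLevelCensusIndexV1 (KIdx)
open B9PinMembersKLevelV1 (MemberY geo9Y bg9Y)
open B9PinCarriersKLevelV1 (carriersY)
open B9PinGeometryKLevelV1 (inΛY unitDistY c35Y)
open B7Prop2SpecialUnitary (specialUnitaryUnits)
open B9Eq39Adjoint (R)
open B9Eq3132SectDLetters (GDY QGQY QGQinvY HDY withSectD)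
open B9Ineq349SiteReading (p349SiteY fineKernelOfSiteOp opsYS349OfLetters)
open scoped Matrix

noncomputable section

variable {d ℓ : ℕ} {hd : 1 ≤ d + 1} {hL : Odd (ℓ + 1) ∧ 1 < ℓ + 1} {b₀ b₁ : ℝ} {Mstar : ℕ}
variable {𝔸 : Type} [NormedRing 𝔸] [NormedAlgebra ℂ 𝔸] [CompleteSpace 𝔸]

/-! ## §1 The symmetrised site transporter `parSymY` and the R7 faces of the averaging transporter -/

section Transporter

variable (i : KIdx d ℓ hd hL b₀ b₁)

open Classical in
/-- ★ **THE SYMMETRISED SITE TRANSPORTER** `U(Γ_{z,w})`: FILE 2's taxicab contour variable `parSY` for `z ≤ w` in the lexicographic order of the box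
chart, and the INVERSE of the reversed one otherwise — so that `U(Γ_{w,z}) = U(Γ_{z,w})⁻¹` for every pair (print's tacit convention for a reversed
contour; R7). [cite: Balaban1985BackgroundPropagators, (3.19) p.393, (3.24) p.394, (3.40) p.397] -/
def parSymY : SiteParY 𝔸 i := fun U z w => if toLex z.1 ≤ toLex w.1 then parSY i U z w else (parSY i U w z)⁻¹

variable {i}

/-- the `z ≤ w` branch. [cite: Balaban1985BackgroundPropagators, (3.40) p.397, bookkeeping] -/
theorem parSymY_of_le {U : CfgY 𝔸 i} {z w : SiteY i} (h : toLex z.1 ≤ toLex w.1) : parSymY i U z w = parSY i U z w := if_pos h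

/-- the `¬ z ≤ w` branch. [cite: Balaban1985BackgroundPropagators, (3.40) p.397, bookkeeping] -/
theorem parSymY_of_not_le {U : CfgY 𝔸 i} {z w : SiteY i} (h : ¬ toLex z.1 ≤ toLex w.1) : parSymY i U z w = (parSY i U w z)⁻¹ := if_neg h

/-- the trivial taxicab contour: `U(Γ_{z,z}) = 1`. [cite: Balaban1985BackgroundPropagators, (3.40) p.397, bookkeeping] -/
theorem parSY_self (U : CfgY 𝔸 i) (z : SiteY i) : parSY i U z z = 1 := parTaxiV_self _ _

/-- the trivial symmetrised contour: `U(Γ_{z,z}) = 1`. [cite: Balaban1985BackgroundPropagators, (3.40) p.397, bookkeeping] -/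
theorem parSymY_self (U : CfgY 𝔸 i) (z : SiteY i) : parSymY i U z z = 1 := by
  rw [parSymY_of_le le_rfl, parSY_self]

/-- ★ **INVERSE-SYMMETRY** (the R7 repair): `U(Γ_{w,z}) = U(Γ_{z,w})⁻¹` for every pair of sites.
[cite: Balaban1985BackgroundPropagators, (3.24) p.394 (Q′* the adjoint of Q′), (3.40) p.397] -/
theorem parSymY_swap (U : CfgY 𝔸 i) (z w : SiteY i) : parSymY i U w z = (parSymY i U z w)⁻¹ := by
  by_cases h1 : toLex z.1 ≤ toLex w.1
  · by_cases h2 : toLex w.1 ≤ toLex z.1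
    · have hzw : z = w := Subtype.ext (toLex_inj.1 (le_antisymm h1 h2))
      subst hzw
      rw [parSymY_self, inv_one]
    · rw [parSymY_of_not_le h2, parSymY_of_le h1]
  · have h2 : toLex w.1 ≤ toLex z.1 := (le_total _ _).resolve_left h1
    rw [parSymY_of_le h2, parSymY_of_not_le h1, inv_inv]

/-- inverse-symmetry in the binder shape of dag-n06-j's `deltaPrimeAY'_eq_of_inv_symm` (`∀ z z', par U z z' = (par U z' z)⁻¹`).
[cite: Balaban1985BackgroundPropagators, (3.24) p.394, (3.40) p.397, bookkeeping] -/
theorem parSymY_inv_symm (U : CfgY 𝔸 i) : ∀ z z' : SiteY i, parSymY i U z z' = (parSymY i U z' z)⁻¹ := fun z z' => parSymY_swap U z' z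

/-- `U(Γ_{z,w})·U(Γ_{w,z}) = 1`. [cite: Balaban1985BackgroundPropagators, (3.40) p.397, bookkeeping] -/
theorem parSymY_mul_swap (U : CfgY 𝔸 i) (z w : SiteY i) : parSymY i U z w * parSymY i U w z = 1 := by
  rw [parSymY_swap U z w, mul_inv_cancel]

variable (i) in
/-- `U = 1` face: every symmetrised transporter is `1`. [cite: Balaban1985BackgroundPropagators, Cor. 3.5 p.407 (U = 1)] -/
@[simp] theorem parSymY_one (z w : SiteY i) : parSymY (𝔸 := 𝔸) i (fun _ _ => 1) z w = 1 := by
  by_cases h : toLex z.1 ≤ toLex w.1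
  · rw [parSymY_of_le h, parSY_one]
  · rw [parSymY_of_not_le h, parSY_one, inv_one]

variable (i) in
/-- `parSymY` of a `G`-valued configuration is `G`-valued (e.g. `G = SU(N)`: `R(U(Γ))` is unitary, so `R(U(Γ)⁻¹) = R(U(Γ))*`).
[cite: Balaban1985BackgroundPropagators, (3.3) p.391, (3.40) p.397, bookkeeping] -/
theorem parSymY_mem {G : Subgroup 𝔸ˣ} {U : CfgY 𝔸 i} (hU : ∀ μ x, U μ x ∈ G) (z w : SiteY i) : parSymY i U z w ∈ G := by
  by_cases h : toLex z.1 ≤ toLex w.1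
  · rw [parSymY_of_le h]; exact parSY_mem i hU z w
  · rw [parSymY_of_not_le h]; exact G.inv_mem (parSY_mem i hU w z)

variable (i) in
/-- ★ the symmetrised transporter obeys FILE 6's CONTOUR GAUGE LAW `U^u(Γ_{z,w}) = u(z)U(Γ_{z,w})u(w)⁻¹` — so every covariance theorem of FILES 6–7
(generic in `parS` + `IsGaugeLawS`) applies to the v4 chain verbatim. [cite: Balaban1985BackgroundPropagators, (3.28) p.395, (3.32)–(3.34) pp.395–396] -/
theorem parSymY_isGaugeLawS : IsGaugeLawS i (parSymY (𝔸 := 𝔸) i) := by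
  intro g U z w
  by_cases h : toLex z.1 ≤ toLex w.1
  · rw [parSymY_of_le h, parSymY_of_le h]
    exact parSY_isGaugeLawS i g U z w
  · rw [parSymY_of_not_le h, parSymY_of_not_le h, parSY_isGaugeLawS i g U w z]
    simp only [mul_inv_rev, inv_inv, mul_assoc]

/-- the block corner is coordinatewise below every site it is the corner of (`L^j·⌊z_μ/L^j⌋ ≤ z_μ`).
[cite: Balaban1985BackgroundPropagators, (3.19) p.393, bookkeeping] -/
theorem cornerY_le (j : ℕ) (z : SiteY i) : (cornerY i j z).1 ≤ z.1 := fun μ => by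
  rw [cornerY_apply]
  have hb : (0 : ℤ) < (((ℓ + 1) ^ j : ℕ) : ℤ) := by positivity
  exact Int.mul_ediv_self_le hb.ne'

/-- … hence lexicographically below it. [cite: Balaban1985BackgroundPropagators, (3.19) p.393, bookkeeping] -/
theorem toLex_cornerY_le (j : ℕ) (z : SiteY i) : toLex (cornerY i j z).1 ≤ toLex z.1 := Pi.toLex_monotone (cornerY_le j z)

/-- ★ ON THE LEG INTO THE BLOCK the symmetrised transporter IS the taxicab one: `parSymY U c z = parSY U c z` for `c` the corner of (a block containing)
`z` — so the covariant block averaging `Q′_j(U) = QpY` reads print's (3.19) contour unchanged. [cite: Balaban1985BackgroundPropagators, (3.19) p.393] -/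
theorem parSymY_cornerY (U : CfgY 𝔸 i) (j : ℕ) (z : SiteY i) : parSymY i U (cornerY i j z) z = parSY i U (cornerY i j z) z :=
  parSymY_of_le (toLex_cornerY_le j z)

/-- ★ ON THE LEG OUT OF THE BLOCK it is the INVERSE: `parSymY U z c = (parSY U c z)⁻¹` — the adjoint leg of (3.24).
[cite: Balaban1985BackgroundPropagators, (3.24) p.394] -/
theorem parSymY_cornerY' (U : CfgY 𝔸 i) (j : ℕ) (z : SiteY i) : parSymY i U z (cornerY i j z) = (parSY i U (cornerY i j z) z)⁻¹ := by
  rw [parSymY_swap, parSymY_cornerY]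

/-- ★★ **R7 REPAIRED AT THE LETTER**: over the symmetrised transporter FILE 3's averaging transporter is `U(Γ_{c,z})⁻¹ · U(Γ_{c,w})` — (3.24)'s
`Q′_j(U)* Q′_j(U)` pair (`c` the corner of the block of `z` at its level). [cite: Balaban1985BackgroundPropagators, (3.24) p.394 with (3.19) p.393] -/
theorem avgTrY_parSymY (U : CfgY 𝔸 i) (z w : SiteY i) :
    avgTrY i (parSymY i) U z w = (parSY i U (cornerY i (levY i z) z) z)⁻¹ * parSymY i U (cornerY i (levY i z) z) w := by
  rw [avgTrY, parSymY_cornerY']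

/-- … and for `w` in the same block BOTH legs are taxicab contours from the corner: `U(Γ_{c,z})⁻¹·U(Γ_{c,w})`.
[cite: Balaban1985BackgroundPropagators, (3.24) p.394 with (3.19) p.393] -/
theorem avgTrY_parSymY_of_corner_eq (U : CfgY 𝔸 i) (z w : SiteY i) (h : cornerY i (levY i z) w = cornerY i (levY i z) z) :
    avgTrY i (parSymY i) U z w = (parSY i U (cornerY i (levY i z) z) z)⁻¹ * parSY i U (cornerY i (levY i z) z) w := by
  rw [avgTrY_parSymY, show parSymY i U (cornerY i (levY i z) z) w = parSY i U (cornerY i (levY i z) z) w from by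
    rw [← h]; exact parSymY_cornerY U _ w]

/-- ★★ **THE AVERAGING KERNEL IS INVERSE-SYMMETRIC ON BLOCKS**: for two sites with the same corner (same block, same level)
`avgTr(U)(w, z) = avgTr(U)(z, w)⁻¹` — with unitary values `R(avgTr(w,z)) = R(avgTr(z,w))*`, the symmetry of `Δ′_a(U)`'s averaging term (p. 416 «It
is a symmetric and invertible operator»); the face row 17's `symm0` is discharged from. [cite: Balaban1985BackgroundPropagators, (3.24) p.394, p.416] -/
theorem avgTrY_parSymY_swap (U : CfgY 𝔸 i) (z w : SiteY i) (h : cornerY i (levY i w) w = cornerY i (levY i z) z) :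
    avgTrY i (parSymY i) U w z = (avgTrY i (parSymY i) U z w)⁻¹ := by
  rw [avgTrY, avgTrY, h, mul_inv_rev, ← parSymY_swap, ← parSymY_swap]

/-- `Δ′_a(U)` over the symmetrised transporter, evaluated: the covariant Laplacian plus the averaging kernel with (3.24)'s adjoint pair.
[cite: Balaban1985BackgroundPropagators, (3.24) p.394] -/
theorem deltaPrimeAY_parSymY_apply (U : CfgY 𝔸 i) (Λ : SiteY i → 𝔸) (z : SiteY i) :
    deltaPrimeAY i (parSymY i) U Λ z =
      lapS i U Λ z + ∑ w, ((avgCoeffY i z w : ℝ) : ℂ) • R ((parSY i U (cornerY i (levY i z) z) z)⁻¹ * parSymY i U (cornerY i (levY i z) z) w) (Λ w) := by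
  simp_rw [deltaPrimeAY_apply, avgTrY_parSymY]

end Transporter

/-! ## §2 The v4 chain at a member: symmetrised transporters → `G′` → `G, (Q′G′²Q′*)⁻¹` → `G(Ω′)`, Sect. D∕E letters -/

section Chain

variable (𝔸)

/-- ★ the UPGRADE of a letter family to the SYMMETRISED site transporter (bond transporter: FILE 2's `parBY`, unchanged — `Q*(U) = QsY` already uses the
inverse contour variables). [cite: Balaban1985BackgroundPropagators, (3.19) p.393, (3.24) p.394, (3.40) p.397] -/
def CovLettersY.withTransportS {x : MemberY d ℓ hd hL b₀ b₁ Mstar} (𝔏 : CovLettersY 𝔸 x) : CovLettersY 𝔸 x :=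
  { 𝔏 with
    parS := parSymY x.toKIdx
    parB := parBY x.toKIdx
    parS_one := fun z z' => parSymY_one x.toKIdx z z'
    parB_one := fun s s' => parBY_one x.toKIdx s s' }

variable (x : MemberY d ℓ hd hL b₀ b₁ Mstar)

/-- the flat family with symmetrised transporters and the genuine `G′`. [cite: Balaban1985BackgroundPropagators, (3.24)–(3.25) pp.394–395] -/
def covLettersY_TGpS : CovLettersY 𝔸 x := ((covLettersY_flat 𝔸 x).withTransportS 𝔸).withGp 𝔸

/-- ★ **def-Y's v2S family**: symmetrised transporters, genuine `G′ = Δ′_a⁻¹`, `G = Δ_a⁻¹`, `C = (Q′G′²Q′*)⁻¹` (FILE 4's `withGAC`).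
[cite: Balaban1985BackgroundPropagators, (3.25)–(3.27) p.395, (3.48) p.398] -/
def covLettersY_v2S : CovLettersY 𝔸 x := (covLettersY_TGpS 𝔸 x).withGAC 𝔸

/-- its site transporter is the symmetrised one. [cite: Balaban1985BackgroundPropagators, (3.40) p.397, bookkeeping] -/
theorem covLettersY_v2S_parS : (covLettersY_v2S 𝔸 x).parS = parSymY x.toKIdx := rfl
/-- its bond transporter is the taxicab one. [cite: Balaban1985BackgroundPropagators, (3.40) p.397, bookkeeping] -/
theorem covLettersY_v2S_parB : (covLettersY_v2S 𝔸 x).parB = parBY x.toKIdx := rfl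
/-- its `G′`. [cite: Balaban1985BackgroundPropagators, (3.25) p.395, bookkeeping] -/
theorem covLettersY_v2S_Gp : (covLettersY_v2S 𝔸 x).Gp = GpY x.toKIdx (parSymY x.toKIdx) := rfl
/-- its `G = Δ_a⁻¹`. [cite: Balaban1985BackgroundPropagators, (3.27) p.395, bookkeeping] -/
theorem covLettersY_v2S_GA :
    (covLettersY_v2S 𝔸 x).GA = GAY x.toKIdx (parSymY x.toKIdx) (parBY x.toKIdx) (GpY x.toKIdx (parSymY x.toKIdx)) := rfl
/-- its `C = (Q′G′²Q′*)⁻¹`. [cite: Balaban1985BackgroundPropagators, (3.48) p.398, bookkeeping] -/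
theorem covLettersY_v2S_C : (covLettersY_v2S 𝔸 x).C = CY x.toKIdx (parSymY x.toKIdx) (GpY x.toKIdx (parSymY x.toKIdx)) := rfl
/-- the PINS of the v2S family (the hypotheses `hGp ∕ hGA` of the N06 faces at generic letters hold by `rfl`).
[cite: Balaban1985BackgroundPropagators, (3.25)–(3.27) p.395, (3.48) p.398, bookkeeping] -/
theorem covLettersY_v2S_pins :
    (covLettersY_v2S 𝔸 x).Gp = GpY x.toKIdx (covLettersY_v2S 𝔸 x).parS ∧
      (covLettersY_v2S 𝔸 x).GA = GAY x.toKIdx (covLettersY_v2S 𝔸 x).parS (covLettersY_v2S 𝔸 x).parB (covLettersY_v2S 𝔸 x).Gp ∧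
      (covLettersY_v2S 𝔸 x).C = CY x.toKIdx (covLettersY_v2S 𝔸 x).parS (covLettersY_v2S 𝔸 x).Gp := ⟨rfl, rfl, rfl⟩

variable {x} in
/-- ★ `G(U) = Δ_a(U)⁻¹` (3.27) AT AN INDEX over the symmetrised transporters (`= (covLettersY_v2S 𝔸 x).GA` at `i = x.toKIdx`, `rfl`).
[cite: Balaban1985BackgroundPropagators, (3.27) p.395, Thm 3.3 p.399] -/
def GAv4Y (i : KIdx d ℓ hd hL b₀ b₁) : BondOpY 𝔸 i := GAY i (parSymY i) (parBY i) (GpY i (parSymY i))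

/-- `(covLettersY_v2S 𝔸 x).GA` is `GAv4Y` at the member's index. [cite: Balaban1985BackgroundPropagators, (3.27) p.395, bookkeeping] -/
theorem covLettersY_v2S_GA_eq : (covLettersY_v2S 𝔸 x).GA = GAv4Y 𝔸 x.toKIdx := rfl

/-- `G(Ω′, U)` for the SECOND sequence of the member, over the symmetrised transporters. [cite: Balaban1985BackgroundPropagators, Thm 3.14 pp.426–427] -/
def GAsndSY : BondOpY 𝔸 x.toKIdx := (GAv4Y 𝔸 x.snd : BondOpY 𝔸 x.snd)

/-- ★ Theorem 3.14's letter `G(Ω, U) − G(Ω′, U)` over the symmetrised transporters. [cite: Balaban1985BackgroundPropagators, Thm 3.14 (3.154) pp.426–427] -/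
def KdiffSY : BondOpY 𝔸 x.toKIdx := fun U => GAv4Y 𝔸 x.toKIdx U - GAsndSY 𝔸 x U

variable {x} in
/-- at a DIAGONAL member the difference vanishes. [cite: Balaban1985BackgroundPropagators, Thm 3.14 pp.426–427, bookkeeping] -/
theorem KdiffSY_diag (i : KIdx d ℓ hd hL b₀ b₁) (hcf : i.cf = (((ℓ + 1 : ℕ) : ℝ)) ^ i.k) (hM : Mstar ≤ (ℓ + 1) * i.Mh) :
    KdiffSY 𝔸 (MemberY.diag (Mstar := Mstar) i hcf hM) = fun _ => 0 :=
  funext fun _ => sub_self _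

/-- ★★ **def-Y's v4 FAMILY** `= withSectD ∘ withDE ∘ v2S`: the Sect. B letters over the symmetrised transporters, then FILE 7's Sect. D∕E update
(`G₁, 𝔊, Kdiff, H₁, (QG₁Q*)⁻¹` over a residual `Δ⁽²⁾`) and `B9Eq3132SectDLetters.withSectD` (`G̃, (QG̃Q*)⁻¹, H`).
[cite: Balaban1985BackgroundPropagators, (3.25)–(3.27) p.395, (3.48) p.398, (3.122)–(3.132) pp.420–422, (3.153) p.426, Thm 3.14 pp.426–427] -/
def covLettersY_v4 (𝔯 : ResLettersY 𝔸 x) : CovLettersY 𝔸 x := withSectD 𝔸 ((covLettersY_v2S 𝔸 x).withDE 𝔸 (GAsndSY 𝔸 x) 𝔯)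

variable {x}
variable (𝔯 : ResLettersY 𝔸 x)

/-- its `GD` is Sect. D's `G̃`. [cite: Balaban1985BackgroundPropagators, (3.122) p.420, bookkeeping] -/
theorem covLettersY_v4_GD : (covLettersY_v4 𝔸 x 𝔯).GD = GDY x.toKIdx (parSymY x.toKIdx) (parBY x.toKIdx) (GpY x.toKIdx (parSymY x.toKIdx)) := rfl
/-- its `H`. [cite: Balaban1985BackgroundPropagators, (3.126) p.421, bookkeeping] -/
theorem covLettersY_v4_H : (covLettersY_v4 𝔸 x 𝔯).H = HDY x.toKIdx (parSymY x.toKIdx) (parBY x.toKIdx) (GpY x.toKIdx (parSymY x.toKIdx)) := rfl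
/-- its `QGQinv`. [cite: Balaban1985BackgroundPropagators, (3.132) p.422, bookkeeping] -/
theorem covLettersY_v4_QGQinv :
    (covLettersY_v4 𝔸 x 𝔯).QGQinv = QGQinvY x.toKIdx (parSymY x.toKIdx) (parBY x.toKIdx) (GpY x.toKIdx (parSymY x.toKIdx)) := rfl
/-- its `G₁`. [cite: Balaban1985BackgroundPropagators, (3.129) p.421, bookkeeping] -/
theorem covLettersY_v4_G₁ :
    (covLettersY_v4 𝔸 x 𝔯).G₁ = G1Y x.toKIdx (parSymY x.toKIdx) (parBY x.toKIdx) (GpY x.toKIdx (parSymY x.toKIdx)) 𝔯.Δ2 := rfl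
/-- its `H₁`. [cite: Balaban1985BackgroundPropagators, (3.129) p.421, bookkeeping] -/
theorem covLettersY_v4_H₁ :
    (covLettersY_v4 𝔸 x 𝔯).H₁ = H1Y x.toKIdx (parSymY x.toKIdx) (parBY x.toKIdx) (GpY x.toKIdx (parSymY x.toKIdx)) 𝔯.Δ2 := rfl
/-- its `QG1Qinv`. [cite: Balaban1985BackgroundPropagators, (3.132) p.422, bookkeeping] -/
theorem covLettersY_v4_QG1Qinv :
    (covLettersY_v4 𝔸 x 𝔯).QG1Qinv = QG1QinvY x.toKIdx (parSymY x.toKIdx) (parBY x.toKIdx) (GpY x.toKIdx (parSymY x.toKIdx)) 𝔯.Δ2 := rfl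
/-- its `GG = 𝔊`. [cite: Balaban1985BackgroundPropagators, (3.153) p.426, bookkeeping] -/
theorem covLettersY_v4_GG :
    (covLettersY_v4 𝔸 x 𝔯).GG = GGY x.toKIdx (parSymY x.toKIdx) (parBY x.toKIdx) (GpY x.toKIdx (parSymY x.toKIdx)) 𝔯.Δ2 := rfl
/-- ★ its `Kdiff` IS Theorem 3.14's `G(Ω, U) − G(Ω′, U)`. [cite: Balaban1985BackgroundPropagators, Thm 3.14 pp.426–427, bookkeeping] -/
theorem covLettersY_v4_Kdiff : (covLettersY_v4 𝔸 x 𝔯).Kdiff = KdiffSY 𝔸 x := rfl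
/-- its `GA` is v2S's `Δ_a⁻¹`. [cite: Balaban1985BackgroundPropagators, (3.27) p.395, bookkeeping] -/
theorem covLettersY_v4_GA : (covLettersY_v4 𝔸 x 𝔯).GA = (covLettersY_v2S 𝔸 x).GA := rfl
/-- its `C` is v2S's `(Q′G′²Q′*)⁻¹`. [cite: Balaban1985BackgroundPropagators, (3.48) p.398, bookkeeping] -/
theorem covLettersY_v4_C : (covLettersY_v4 𝔸 x 𝔯).C = (covLettersY_v2S 𝔸 x).C := rfl
/-- its `G′`. [cite: Balaban1985BackgroundPropagators, (3.25) p.395, bookkeeping] -/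
theorem covLettersY_v4_Gp : (covLettersY_v4 𝔸 x 𝔯).Gp = GpY x.toKIdx (parSymY x.toKIdx) := rfl
/-- its site transporters are the symmetrised ones. [cite: Balaban1985BackgroundPropagators, (3.40) p.397, bookkeeping] -/
theorem covLettersY_v4_parS : (covLettersY_v4 𝔸 x 𝔯).parS = parSymY x.toKIdx := rfl
/-- its bond transporters are the taxicab ones. [cite: Balaban1985BackgroundPropagators, (3.40) p.397, bookkeeping] -/
theorem covLettersY_v4_parB : (covLettersY_v4 𝔸 x 𝔯).parB = parBY x.toKIdx := rfl
/-- its block-sector `P349 ∕ Ck` slots are the flat `0` (the genuine readings live in the LAYER: `opsYS349OfLetters` ∕ `opsYSectE`, §4).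
[cite: Balaban1985BackgroundPropagators, (3.49) p.399, (3.185) p.432, bookkeeping] -/
theorem covLettersY_v4_P349_Ck : (covLettersY_v4 𝔸 x 𝔯).P349 = (fun _ => 0) ∧ (covLettersY_v4 𝔸 x 𝔯).Ck = (fun _ => 0) := ⟨rfl, rfl⟩
/-- the PINS of the v4 family. [cite: Balaban1985BackgroundPropagators, (3.25)–(3.27) p.395, (3.48) p.398, bookkeeping] -/
theorem covLettersY_v4_pins :
    (covLettersY_v4 𝔸 x 𝔯).Gp = GpY x.toKIdx (covLettersY_v4 𝔸 x 𝔯).parS ∧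
      (covLettersY_v4 𝔸 x 𝔯).GA = GAY x.toKIdx (covLettersY_v4 𝔸 x 𝔯).parS (covLettersY_v4 𝔸 x 𝔯).parB (covLettersY_v4 𝔸 x 𝔯).Gp ∧
      (covLettersY_v4 𝔸 x 𝔯).C = CY x.toKIdx (covLettersY_v4 𝔸 x 𝔯).parS (covLettersY_v4 𝔸 x 𝔯).Gp := ⟨rfl, rfl, rfl⟩
/-- `v4 = withSectD (v2S.withDE (G(Ω′)) 𝔯)`, by name. [cite: Balaban1985BackgroundPropagators, (3.122)–(3.132) pp.420–422, bookkeeping] -/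
theorem covLettersY_v4_eq_withSectD : covLettersY_v4 𝔸 x 𝔯 = withSectD 𝔸 ((covLettersY_v2S 𝔸 x).withDE 𝔸 (GAsndSY 𝔸 x) 𝔯) := rfl

/-- the two `(3.132)` letters of v4 are `Ring.inverse` of NAMED operators (dag-n06-i's `hT ∕ hT₁ := fun _ _ => rfl` shape for row 26).
[cite: Balaban1985BackgroundPropagators, (3.132) p.422, bookkeeping] -/
theorem covLettersY_v4_QGQinv_QG1Qinv_ringInverse (U : CfgY 𝔸 x.toKIdx) :
    (covLettersY_v4 𝔸 x 𝔯).QGQinv U = Ring.inverse (QGQY x.toKIdx (parSymY x.toKIdx) (parBY x.toKIdx) (GpY x.toKIdx (parSymY x.toKIdx)) U) ∧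
    (covLettersY_v4 𝔸 x 𝔯).QG1Qinv U =
      Ring.inverse (QGQOfY x.toKIdx (parBY x.toKIdx) (G1Y x.toKIdx (parSymY x.toKIdx) (parBY x.toKIdx) (GpY x.toKIdx (parSymY x.toKIdx)) 𝔯.Δ2) U) :=
  ⟨rfl, rfl⟩

end Chain

/-! ## §3 (3.33)–(3.34) for the v4 chain: gauge covariance, verbatim from FILES 6–7 through `parSymY_isGaugeLawS` -/

section ChainCov

variable (𝔸) in
/-- `G(U)` over the symmetrised transporters is covariant. [cite: Balaban1985BackgroundPropagators, (3.34) p.396] -/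
theorem GAv4Y_isCovBondOpY (i : KIdx d ℓ hd hL b₀ b₁) : IsCovBondOpY i (GAv4Y 𝔸 i) :=
  GAY_isCovBondOpY (parSymY_isGaugeLawS i) (parBY_isGaugeLawB i) (GpY_isCovSiteOpY (parSymY_isGaugeLawS i))

variable {x : MemberY d ℓ hd hL b₀ b₁ Mstar} (g : GaugeY 𝔸 x.toKIdx) (U : CfgY 𝔸 x.toKIdx)

variable (𝔸 x) in
/-- `G(Ω′, U)` is covariant. [cite: Balaban1985BackgroundPropagators, Thm 3.14 pp.426–427, (3.34) p.396] -/
theorem GAsndSY_isCovBondOpY : IsCovBondOpY x.toKIdx (GAsndSY 𝔸 x) := fun g U => GAv4Y_isCovBondOpY 𝔸 x.snd g U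

/-- Theorem 3.14's letter is covariant. [cite: Balaban1985BackgroundPropagators, Thm 3.14 pp.426–427, (3.34) p.396] -/
theorem KdiffSY_cov : Intw (conjY (gBondY x.toKIdx g)) (conjY (gBondY x.toKIdx g)) (KdiffSY 𝔸 x U) (KdiffSY 𝔸 x (gaugeY x.toKIdx g U)) :=
  (GAv4Y_isCovBondOpY 𝔸 x.toKIdx g U).sub (GAsndSY_isCovBondOpY 𝔸 x g U)

/-- the v2S family's `G′(U)` is covariant. [cite: Balaban1985BackgroundPropagators, (3.33) p.396] -/
theorem covLettersY_v2S_Gp_cov :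
    Intw (conjY (gSiteY x.toKIdx g)) (conjY (gSiteY x.toKIdx g)) ((covLettersY_v2S 𝔸 x).Gp U) ((covLettersY_v2S 𝔸 x).Gp (gaugeY x.toKIdx g U)) :=
  GpY_cov g U (parSymY_isGaugeLawS x.toKIdx)

/-- the v2S family's `C(U)` is covariant. [cite: Balaban1985BackgroundPropagators, (3.33) p.396, (3.48) p.398] -/
theorem covLettersY_v2S_C_cov :
    Intw (conjY (gBlkY x.toKIdx g)) (conjY (gBlkY x.toKIdx g)) ((covLettersY_v2S 𝔸 x).C U) ((covLettersY_v2S 𝔸 x).C (gaugeY x.toKIdx g U)) :=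
  CY_cov (parSymY_isGaugeLawS x.toKIdx) (GpY_isCovSiteOpY (parSymY_isGaugeLawS x.toKIdx))

/-- the v2S family's `G(U)` is covariant. [cite: Balaban1985BackgroundPropagators, (3.34) p.396] -/
theorem covLettersY_v2S_GA_cov :
    Intw (conjY (gBondY x.toKIdx g)) (conjY (gBondY x.toKIdx g)) ((covLettersY_v2S 𝔸 x).GA U) ((covLettersY_v2S 𝔸 x).GA (gaugeY x.toKIdx g U)) :=
  GAY_cov (parSymY_isGaugeLawS x.toKIdx) (parBY_isGaugeLawB x.toKIdx) (GpY_isCovSiteOpY (parSymY_isGaugeLawS x.toKIdx))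

/-- ★★ **THE v4 LETTERS ARE GAUGE COVARIANT** for a covariant residual `Δ⁽²⁾` (FILE 7's `covLettersY_v3_cov`, now over `parSymY`).
[cite: Balaban1985BackgroundPropagators, (3.33)–(3.34) p.396, (3.119)–(3.153) pp.419–426, Thm 3.14 pp.426–427] -/
theorem covLettersY_v4_cov (𝔯 : ResLettersY 𝔸 x) (hΔ : IsCovBondOpY x.toKIdx 𝔯.Δ2) :
    Intw (conjY (gBondY x.toKIdx g)) (conjY (gBondY x.toKIdx g)) ((covLettersY_v4 𝔸 x 𝔯).GD U) ((covLettersY_v4 𝔸 x 𝔯).GD (gaugeY x.toKIdx g U)) ∧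
      Intw (conjY (gBondY x.toKIdx g)) (conjY (gBondY x.toKIdx g)) ((covLettersY_v4 𝔸 x 𝔯).G₁ U) ((covLettersY_v4 𝔸 x 𝔯).G₁ (gaugeY x.toKIdx g U)) ∧
      Intw (conjY (gBondY x.toKIdx g)) (conjY (gBondY x.toKIdx g)) ((covLettersY_v4 𝔸 x 𝔯).GG U) ((covLettersY_v4 𝔸 x 𝔯).GG (gaugeY x.toKIdx g U)) ∧
      Intw (conjY (gBondY x.toKIdx g)) (conjY (gBondY x.toKIdx g)) ((covLettersY_v4 𝔸 x 𝔯).Kdiff U) ((covLettersY_v4 𝔸 x 𝔯).Kdiff (gaugeY x.toKIdx g U)) ∧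
      Intw (conjY (gIBondY x.toKIdx g)) (conjY (gBondY x.toKIdx g)) ((covLettersY_v4 𝔸 x 𝔯).H U) ((covLettersY_v4 𝔸 x 𝔯).H (gaugeY x.toKIdx g U)) ∧
      Intw (conjY (gIBondY x.toKIdx g)) (conjY (gBondY x.toKIdx g)) ((covLettersY_v4 𝔸 x 𝔯).H₁ U) ((covLettersY_v4 𝔸 x 𝔯).H₁ (gaugeY x.toKIdx g U)) ∧
      Intw (conjY (gIBondY x.toKIdx g)) (conjY (gIBondY x.toKIdx g)) ((covLettersY_v4 𝔸 x 𝔯).QGQinv U)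
        ((covLettersY_v4 𝔸 x 𝔯).QGQinv (gaugeY x.toKIdx g U)) ∧
      Intw (conjY (gIBondY x.toKIdx g)) (conjY (gIBondY x.toKIdx g)) ((covLettersY_v4 𝔸 x 𝔯).QG1Qinv U)
        ((covLettersY_v4 𝔸 x 𝔯).QG1Qinv (gaugeY x.toKIdx g U)) :=
  have hS := parSymY_isGaugeLawS (𝔸 := 𝔸) x.toKIdx
  have hB := parBY_isGaugeLawB (𝔸 := 𝔸) x.toKIdx
  have hGp := GpY_isCovSiteOpY hS
  ⟨GDY_cov hS hB hGp, G1Y_cov hS hB hGp hΔ, GGY_cov hS hB hGp hΔ, KdiffSY_cov g U, HDY_cov hS hB hGp, H1Y_cov hS hB hGp hΔ,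
    QGQinvY_cov hS hB hGp, QG1QinvY_cov hS hB hGp hΔ⟩

end ChainCov

/-! ## §4 AT THE RECORD: the v4 letters, `opsYOfRecordV4`, the (3.49) layer and ★ the v4 INSTANCE OF RECORD `opsYOfRecordV4E` -/

section Record

open scoped Matrix.Norms.L2Operator

/-- ★ **THE v4 LETTERS OF RECORD**: the v4 family at every member of Stage 3′(Y), `𝔸 = M_N(ℂ)`, over a residual family `𝔯`.
[cite: Balaban1985BackgroundPropagators, (3.19) p.393, (3.24)–(3.27) pp.394–395, (3.48) p.398, (3.122)–(3.132) pp.420–422, (3.153) p.426, Thm 3.14 pp.426–427] -/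
def lettersYOfRecordV4 (N : ℕ) (θ : Stage3Params) (Mstar : ℕ) (𝔯 : ResY N θ Mstar) : LettersY N θ Mstar :=
  fun x => covLettersY_v4 (Matrix (Fin N) (Fin N) ℂ) x (𝔯 x)

/-- the v4 `OpsY` instance WITHOUT the two layer readings (FILE 1's constructor at the v4 letters; rows 23–25 flat through this one).
[cite: Balaban1985BackgroundPropagators, Thms 3.1–3.14 pp.397–427] -/
def opsYOfRecordV4 (N : ℕ) (θ : Stage3Params) (Mstar : ℕ) (𝔯 : ResY N θ Mstar) (𝔈 : ExpsY N θ Mstar) : OpsY N θ Mstar :=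
  opsYOfLetters N θ Mstar (lettersYOfRecordV4 N θ Mstar 𝔯) 𝔈

/-- the v4 instance with dag-n06-i's genuine site-sector (3.49) reading in `P349` (their generic constructor, by name).
[cite: Balaban1985BackgroundPropagators, (3.49) p.399] -/
def opsYS349OfRecordV4 (N : ℕ) (θ : Stage3Params) (Mstar : ℕ) (𝔯 : ResY N θ Mstar) (𝔈 : ExpsY N θ Mstar) : OpsY N θ Mstar :=
  opsYS349OfLetters N θ Mstar (lettersYOfRecordV4 N θ Mstar 𝔯) 𝔈

/-- ★★★ **THE v4 INSTANCE OF RECORD** of Stage 3′(Y): symmetrised transporters, the genuine Sect. B∕D letters, `G(Ω′)`, the (3.49) site reading, and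
FILE 8's `C^{(k)}(Λ; U)` (3.156)–(3.158) with the (3.185) ∕ expansion slots over the Sect. E letters `𝔢` and the walk letters `𝔴`.
[cite: Balaban1985BackgroundPropagators, Thms 3.1–3.15 pp.397–432] -/
def opsYOfRecordV4E (N : ℕ) (θ : Stage3Params) (Mstar : ℕ) (𝔯 : ResY N θ Mstar) (𝔢 : SectEY N θ Mstar) (𝔴 : RWEY N θ Mstar)
    (𝔈 : ExpsY N θ Mstar) : OpsY N θ Mstar :=
  opsYSectE N θ Mstar (opsYS349OfRecordV4 N θ Mstar 𝔯 𝔈) (lettersYOfRecordV4 N θ Mstar 𝔯) 𝔢 𝔴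

variable (N : ℕ) (θ : Stage3Params) (Mstar : ℕ) (𝔯 : ResY N θ Mstar) (𝔢 : SectEY N θ Mstar) (𝔴 : RWEY N θ Mstar) (𝔈 : ExpsY N θ Mstar)

/-- the v4 letters of record at a member are the v4 family. [cite: Balaban1985BackgroundPropagators, (3.122)–(3.132) pp.420–422, bookkeeping] -/
theorem lettersYOfRecordV4_apply (x : MemberY θ.d₆ θ.ℓ₆ θ.hd' θ.hL' θ.b₀ θ.b₁ Mstar) :
    lettersYOfRecordV4 N θ Mstar 𝔯 x = covLettersY_v4 (Matrix (Fin N) (Fin N) ℂ) x (𝔯 x) := rfl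

/-- the v4 record's site transporter is the symmetrised one. [cite: Balaban1985BackgroundPropagators, (3.24) p.394, (3.40) p.397, bookkeeping] -/
theorem lettersYOfRecordV4_parS (x : MemberY θ.d₆ θ.ℓ₆ θ.hd' θ.hL' θ.b₀ θ.b₁ Mstar) : (lettersYOfRecordV4 N θ Mstar 𝔯 x).parS = parSymY x.toKIdx := rfl

/-- the v4 record's bond transporter is the taxicab one. [cite: Balaban1985BackgroundPropagators, (3.40) p.397, bookkeeping] -/
theorem lettersYOfRecordV4_parB (x : MemberY θ.d₆ θ.ℓ₆ θ.hd' θ.hL' θ.b₀ θ.b₁ Mstar) : (lettersYOfRecordV4 N θ Mstar 𝔯 x).parB = parBY x.toKIdx := rfl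

/-- the Sect. B letters of the v4 record, by name. [cite: Balaban1985BackgroundPropagators, (3.25)–(3.27) p.395, (3.48) p.398, bookkeeping] -/
theorem lettersYOfRecordV4_sectB (x : MemberY θ.d₆ θ.ℓ₆ θ.hd' θ.hL' θ.b₀ θ.b₁ Mstar) :
    (lettersYOfRecordV4 N θ Mstar 𝔯 x).parS = parSymY x.toKIdx ∧ (lettersYOfRecordV4 N θ Mstar 𝔯 x).parB = parBY x.toKIdx ∧
      (lettersYOfRecordV4 N θ Mstar 𝔯 x).Gp = GpY x.toKIdx (parSymY x.toKIdx) ∧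
      (lettersYOfRecordV4 N θ Mstar 𝔯 x).GA = GAv4Y (Matrix (Fin N) (Fin N) ℂ) x.toKIdx ∧
      (lettersYOfRecordV4 N θ Mstar 𝔯 x).C = CY x.toKIdx (parSymY x.toKIdx) (GpY x.toKIdx (parSymY x.toKIdx)) := ⟨rfl, rfl, rfl, rfl, rfl⟩

/-- the PINS of the v4 record (`Gp = GpY _ parS`, `GA = GAY _ parS parB Gp`, `C = CY _ parS Gp` — the hypotheses of the N06 faces at generic letters).
[cite: Balaban1985BackgroundPropagators, (3.25)–(3.27) p.395, (3.48) p.398, bookkeeping] -/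
theorem lettersYOfRecordV4_pins (x : MemberY θ.d₆ θ.ℓ₆ θ.hd' θ.hL' θ.b₀ θ.b₁ Mstar) :
    (lettersYOfRecordV4 N θ Mstar 𝔯 x).Gp = GpY x.toKIdx (lettersYOfRecordV4 N θ Mstar 𝔯 x).parS ∧
      (lettersYOfRecordV4 N θ Mstar 𝔯 x).GA =
        GAY x.toKIdx (lettersYOfRecordV4 N θ Mstar 𝔯 x).parS (lettersYOfRecordV4 N θ Mstar 𝔯 x).parB (lettersYOfRecordV4 N θ Mstar 𝔯 x).Gp ∧
      (lettersYOfRecordV4 N θ Mstar 𝔯 x).C = CY x.toKIdx (lettersYOfRecordV4 N θ Mstar 𝔯 x).parS (lettersYOfRecordV4 N θ Mstar 𝔯 x).Gp :=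
  ⟨rfl, rfl, rfl⟩

/-- the Sect. D∕E letters of the v4 record, by name. [cite: Balaban1985BackgroundPropagators, (3.122)–(3.132) pp.420–422, (3.153) p.426, Thm 3.14 pp.426–427, bookkeeping] -/
theorem lettersYOfRecordV4_sectDE (x : MemberY θ.d₆ θ.ℓ₆ θ.hd' θ.hL' θ.b₀ θ.b₁ Mstar) :
    (lettersYOfRecordV4 N θ Mstar 𝔯 x).GD = GDY x.toKIdx (parSymY x.toKIdx) (parBY x.toKIdx) (GpY x.toKIdx (parSymY x.toKIdx)) ∧
      (lettersYOfRecordV4 N θ Mstar 𝔯 x).QGQinv = QGQinvY x.toKIdx (parSymY x.toKIdx) (parBY x.toKIdx) (GpY x.toKIdx (parSymY x.toKIdx)) ∧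
      (lettersYOfRecordV4 N θ Mstar 𝔯 x).H = HDY x.toKIdx (parSymY x.toKIdx) (parBY x.toKIdx) (GpY x.toKIdx (parSymY x.toKIdx)) ∧
      (lettersYOfRecordV4 N θ Mstar 𝔯 x).G₁ = G1Y x.toKIdx (parSymY x.toKIdx) (parBY x.toKIdx) (GpY x.toKIdx (parSymY x.toKIdx)) (𝔯 x).Δ2 ∧
      (lettersYOfRecordV4 N θ Mstar 𝔯 x).QG1Qinv = QG1QinvY x.toKIdx (parSymY x.toKIdx) (parBY x.toKIdx) (GpY x.toKIdx (parSymY x.toKIdx)) (𝔯 x).Δ2 ∧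
      (lettersYOfRecordV4 N θ Mstar 𝔯 x).H₁ = H1Y x.toKIdx (parSymY x.toKIdx) (parBY x.toKIdx) (GpY x.toKIdx (parSymY x.toKIdx)) (𝔯 x).Δ2 ∧
      (lettersYOfRecordV4 N θ Mstar 𝔯 x).GG = GGY x.toKIdx (parSymY x.toKIdx) (parBY x.toKIdx) (GpY x.toKIdx (parSymY x.toKIdx)) (𝔯 x).Δ2 ∧
      (lettersYOfRecordV4 N θ Mstar 𝔯 x).Kdiff = KdiffSY (Matrix (Fin N) (Fin N) ℂ) x := ⟨rfl, rfl, rfl, rfl, rfl, rfl, rfl, rfl⟩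

/-- ★ at `U = 1` the v4 record's `G₁` acts on product-form arguments as the lift of `Gop` (the `U = 1` clause shape of `CovLettersY.GA_one`, for `G₁`).
[cite: Balaban1985BackgroundPropagators, Cor. 3.5 p.407, (3.129) p.421] -/
theorem lettersYOfRecordV4_G₁_one (x : MemberY θ.d₆ θ.ℓ₆ θ.hd' θ.hL' θ.b₀ θ.b₁ Mstar) (J : FBondY x.toKIdx → ℝ) (E : Matrix (Fin N) (Fin N) ℂ) :
    (lettersYOfRecordV4 N θ Mstar 𝔯 x).G₁ (fun _ _ => 1) (liftY J E) = liftY (B6Prop26Census2136KLevelV1.Gop x.toKIdx J) E :=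
  G1Y_one_liftY x.toKIdx (covLettersY_v2S _ x).parS_one (covLettersY_v2S _ x).parB_one (covLettersY_v2S _ x).Gp_one (𝔯 x).Δ2_one J E

/-- ★ **R7 AT THE RECORD**: the v4 record's averaging transporter is inverse-symmetric on blocks.
[cite: Balaban1985BackgroundPropagators, (3.24) p.394, p.416] -/
theorem lettersYOfRecordV4_avgTr_swap (x : MemberY θ.d₆ θ.ℓ₆ θ.hd' θ.hL' θ.b₀ θ.b₁ Mstar) (U : CfgY (Matrix (Fin N) (Fin N) ℂ) x.toKIdx)
    (z w : SiteY x.toKIdx) (h : cornerY x.toKIdx (levY x.toKIdx w) w = cornerY x.toKIdx (levY x.toKIdx z) z) :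
    avgTrY x.toKIdx (lettersYOfRecordV4 N θ Mstar 𝔯 x).parS U w z = (avgTrY x.toKIdx (lettersYOfRecordV4 N θ Mstar 𝔯 x).parS U z w)⁻¹ :=
  avgTrY_parSymY_swap U z w h

/-- the v4 instance of record at a member, unfolded. [cite: Balaban1985BackgroundPropagators, Thm 3.15 p.432, bookkeeping] -/
theorem opsYOfRecordV4E_apply (x : MemberY θ.d₆ θ.ℓ₆ θ.hd' θ.hL' θ.b₀ θ.b₁ Mstar) :
    opsYOfRecordV4E N θ Mstar 𝔯 𝔢 𝔴 𝔈 x =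
      operatorLayerYSectE (Matrix (Fin N) (Fin N) ℂ) (specialUnitaryUnits (Fin N)) x (opsYS349OfRecordV4 N θ Mstar 𝔯 𝔈 x)
        (lettersYOfRecordV4 N θ Mstar 𝔯 x) (𝔢 x) (𝔴 x) := rfl

/-- ★ ROW 24's kernel at the v4 instance of record. [cite: Balaban1985BackgroundPropagators, Thm 3.15 (3.187) p.432, bookkeeping] -/
theorem opsYOfRecordV4E_Ck (x : MemberY θ.d₆ θ.ℓ₆ θ.hd' θ.hL' θ.b₀ θ.b₁ Mstar) :
    (opsYOfRecordV4E N θ Mstar 𝔯 𝔢 𝔴 𝔈 x).Ck =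
      siteKernelOfOp x.toKIdx (bg9Y (Matrix (Fin N) (Fin N) ℂ) (specialUnitaryUnits (Fin N)) x) (fun U => U)
        (CkY x (lettersYOfRecordV4 N θ Mstar 𝔯 x) (𝔢 x)) id id := rfl

/-- ★ ROW 24's kernel entry at the v4 instance of record. [cite: Balaban1985BackgroundPropagators, Thm 3.15 (3.187) p.432, bookkeeping] -/
theorem opsYOfRecordV4E_Ck_ker (x : MemberY θ.d₆ θ.ℓ₆ θ.hd' θ.hL' θ.b₀ θ.b₁ Mstar)
    (U : (bg9Y (Matrix (Fin N) (Fin N) ℂ) (specialUnitaryUnits (Fin N)) x).Cfg) (y y' : (geo9Y x).Site) :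
    (opsYOfRecordV4E N θ Mstar 𝔯 𝔢 𝔴 𝔈 x).Ck.ker U y y' =
      ⨆ E : BallY (Matrix (Fin N) (Fin N) ℂ), ‖CkY x (lettersYOfRecordV4 N θ Mstar 𝔯 x) (𝔢 x) U (deltaY y' (E : Matrix (Fin N) (Fin N) ℂ)) y‖ := rfl

/-- ★ ROW 24's (3.185) slot at the v4 instance of record. [cite: Balaban1985BackgroundPropagators, Thm 3.15 (3.185) p.432, bookkeeping] -/
theorem opsYOfRecordV4E_GivenBy3185 (x : MemberY θ.d₆ θ.ℓ₆ θ.hd' θ.hL' θ.b₀ θ.b₁ Mstar) :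
    (opsYOfRecordV4E N θ Mstar 𝔯 𝔢 𝔴 𝔈 x).GivenBy3185 = givenBy3185Y x (lettersYOfRecordV4 N θ Mstar 𝔯 x) (𝔢 x) := rfl

/-- ★ ROW 24's expansion slot at the v4 instance of record. [cite: Balaban1985BackgroundPropagators, Thm 3.15 p.432, bookkeeping] -/
theorem opsYOfRecordV4E_HasRWExpC (x : MemberY θ.d₆ θ.ℓ₆ θ.hd' θ.hL' θ.b₀ θ.b₁ Mstar) :
    (opsYOfRecordV4E N θ Mstar 𝔯 𝔢 𝔴 𝔈 x).HasRWExpC = hasRWExpCY (𝔴 x) := rfl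

/-- ★ ROW 25's letter at the v4 instance of record IS dag-n06-i's genuine site-sector (3.49) reading of the v4 letters.
[cite: Balaban1985BackgroundPropagators, (3.49) p.399, bookkeeping] -/
theorem opsYOfRecordV4E_P349 (x : MemberY θ.d₆ θ.ℓ₆ θ.hd' θ.hL' θ.b₀ θ.b₁ Mstar) :
    (opsYOfRecordV4E N θ Mstar 𝔯 𝔢 𝔴 𝔈 x).P349 =
      p349SiteY (Matrix (Fin N) (Fin N) ℂ) (specialUnitaryUnits (Fin N)) x (lettersYOfRecordV4 N θ Mstar 𝔯 x) := rfl

/-- ★ … i.e. THE (3.49) READING OF THE GENUINE `P = I − R = G′Q′*(Q′G′²Q′*)⁻¹Q′G′` OVER THE SYMMETRISED TRANSPORTERS AND `G′ = GpY`.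
[cite: Balaban1985BackgroundPropagators, (3.49) p.399 with (3.25) p.394] -/
theorem opsYOfRecordV4E_P349_eq (x : MemberY θ.d₆ θ.ℓ₆ θ.hd' θ.hL' θ.b₀ θ.b₁ Mstar) :
    (opsYOfRecordV4E N θ Mstar 𝔯 𝔢 𝔴 𝔈 x).P349 =
      fineKernelOfSiteOp x.toKIdx (bg9Y (Matrix (Fin N) (Fin N) ℂ) (specialUnitaryUnits (Fin N)) x) (fun U => U)
        (P349Y x.toKIdx (parSymY x.toKIdx) (GpY x.toKIdx (parSymY x.toKIdx))) := rfl

/-- the other rows' operator letters at the v4 instance of record ARE `opsYOfRecordV4`'s (`Gp GA Cinv GD G₁ H H₁ GG Kdiff QGQinv QG1Qinv`, `rfl`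
through both layers) — rows 4–12, 17, 20–23, 26 transport verbatim. [cite: Balaban1985BackgroundPropagators, Thms 3.1–3.14 pp.397–426, (3.132) p.422, bookkeeping] -/
theorem opsYOfRecordV4E_letters (x : MemberY θ.d₆ θ.ℓ₆ θ.hd' θ.hL' θ.b₀ θ.b₁ Mstar) :
    (opsYOfRecordV4E N θ Mstar 𝔯 𝔢 𝔴 𝔈 x).Gp = (opsYOfRecordV4 N θ Mstar 𝔯 𝔈 x).Gp ∧
      (opsYOfRecordV4E N θ Mstar 𝔯 𝔢 𝔴 𝔈 x).GA = (opsYOfRecordV4 N θ Mstar 𝔯 𝔈 x).GA ∧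
      (opsYOfRecordV4E N θ Mstar 𝔯 𝔢 𝔴 𝔈 x).Cinv = (opsYOfRecordV4 N θ Mstar 𝔯 𝔈 x).Cinv ∧
      (opsYOfRecordV4E N θ Mstar 𝔯 𝔢 𝔴 𝔈 x).GD = (opsYOfRecordV4 N θ Mstar 𝔯 𝔈 x).GD ∧
      (opsYOfRecordV4E N θ Mstar 𝔯 𝔢 𝔴 𝔈 x).G₁ = (opsYOfRecordV4 N θ Mstar 𝔯 𝔈 x).G₁ ∧
      (opsYOfRecordV4E N θ Mstar 𝔯 𝔢 𝔴 𝔈 x).H = (opsYOfRecordV4 N θ Mstar 𝔯 𝔈 x).H ∧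
      (opsYOfRecordV4E N θ Mstar 𝔯 𝔢 𝔴 𝔈 x).H₁ = (opsYOfRecordV4 N θ Mstar 𝔯 𝔈 x).H₁ ∧
      (opsYOfRecordV4E N θ Mstar 𝔯 𝔢 𝔴 𝔈 x).GG = (opsYOfRecordV4 N θ Mstar 𝔯 𝔈 x).GG ∧
      (opsYOfRecordV4E N θ Mstar 𝔯 𝔢 𝔴 𝔈 x).Kdiff = (opsYOfRecordV4 N θ Mstar 𝔯 𝔈 x).Kdiff ∧
      (opsYOfRecordV4E N θ Mstar 𝔯 𝔢 𝔴 𝔈 x).QGQinv = (opsYOfRecordV4 N θ Mstar 𝔯 𝔈 x).QGQinv ∧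
      (opsYOfRecordV4E N θ Mstar 𝔯 𝔢 𝔴 𝔈 x).QG1Qinv = (opsYOfRecordV4 N θ Mstar 𝔯 𝔈 x).QG1Qinv :=
  ⟨rfl, rfl, rfl, rfl, rfl, rfl, rfl, rfl, rfl, rfl, rfl⟩

/-- … and its expansion ∕ predicate letters are `𝔈`'s. [cite: Balaban1985BackgroundPropagators, Thms 3.7–3.13 pp.409–426, bookkeeping] -/
theorem opsYOfRecordV4E_exps (x : MemberY θ.d₆ θ.ℓ₆ θ.hd' θ.hL' θ.b₀ θ.b₁ Mstar) :
    (opsYOfRecordV4E N θ Mstar 𝔯 𝔢 𝔴 𝔈 x).E37 = (𝔈 x).E37 ∧ (opsYOfRecordV4E N θ Mstar 𝔯 𝔢 𝔴 𝔈 x).EK39 = (𝔈 x).EK39 ∧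
      (opsYOfRecordV4E N θ Mstar 𝔯 𝔢 𝔴 𝔈 x).E310 = (𝔈 x).E310 ∧ (opsYOfRecordV4E N θ Mstar 𝔯 𝔢 𝔴 𝔈 x).PosDef = (𝔈 x).PosDef ∧
      (opsYOfRecordV4E N θ Mstar 𝔯 𝔢 𝔴 𝔈 x).IsAnalyticExt = (𝔈 x).IsAnalyticExt ∧ (opsYOfRecordV4E N θ Mstar 𝔯 𝔢 𝔴 𝔈 x).HasRWExp = (𝔈 x).HasRWExp ∧
      (opsYOfRecordV4E N θ Mstar 𝔯 𝔢 𝔴 𝔈 x).HasRWExpH = (𝔈 x).HasRWExpH ∧ (opsYOfRecordV4E N θ Mstar 𝔯 𝔢 𝔴 𝔈 x).PosDefK = (𝔈 x).PosDefK :=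
  ⟨rfl, rfl, rfl, rfl, rfl, rfl, rfl, rfl⟩

/-- the operator letters of `opsYOfRecordV4` read the v4 letters of record through FILE 1's readers (`Gp ∕ GA ∕ Cinv`, by name).
[cite: Balaban1985BackgroundPropagators, Thms 3.1–3.3 pp.397–399, bookkeeping] -/
theorem opsYOfRecordV4_eq (x : MemberY θ.d₆ θ.ℓ₆ θ.hd' θ.hL' θ.b₀ θ.b₁ Mstar) :
    opsYOfRecordV4 N θ Mstar 𝔯 𝔈 x = opsYOfLetters N θ Mstar (lettersYOfRecordV4 N θ Mstar 𝔯) 𝔈 x ∧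
      opsYS349OfRecordV4 N θ Mstar 𝔯 𝔈 x = opsYS349OfLetters N θ Mstar (lettersYOfRecordV4 N θ Mstar 𝔯) 𝔈 x := ⟨rfl, rfl⟩

/-- the [B9] bundle of record at the v4 instance of record. [cite: Balaban1985BackgroundPropagators, Thms 3.1–3.15 pp.397–432, bookkeeping] -/
theorem Y9OfRecord_opsYOfRecordV4E :
    Y9OfRecord N θ Mstar (opsYOfRecordV4E N θ Mstar 𝔯 𝔢 𝔴 𝔈) =
      carriersY θ.d₆ θ.ℓ₆ θ.hd' θ.hL' θ.b₀ θ.b₁ Mstar (Matrix (Fin N) (Fin N) ℂ) (specialUnitaryUnits (Fin N)) (opsYOfRecordV4E N θ Mstar 𝔯 𝔢 𝔴 𝔈) :=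
  rfl

/-- the [B9] bundle of record at the v4 instance without the layer readings. [cite: Balaban1985BackgroundPropagators, Thms 3.1–3.15 pp.397–432, bookkeeping] -/
theorem Y9OfRecord_opsYOfRecordV4 :
    Y9OfRecord N θ Mstar (opsYOfRecordV4 N θ Mstar 𝔯 𝔈) =
      carriersY θ.d₆ θ.ℓ₆ θ.hd' θ.hL' θ.b₀ θ.b₁ Mstar (Matrix (Fin N) (Fin N) ℂ) (specialUnitaryUnits (Fin N)) (opsYOfRecordV4 N θ Mstar 𝔯 𝔈) := rfl

/-- at the FLAT Sect. E family the v4 instance's `Ck` kernel vanishes identically (row 24 vacuous there — the honesty guard's first half).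
[cite: Balaban1985BackgroundPropagators, Thm 3.15 (3.187) p.432, bookkeeping] -/
theorem opsYOfRecordV4E_Ck_ker_flat (x : MemberY θ.d₆ θ.ℓ₆ θ.hd' θ.hL' θ.b₀ θ.b₁ Mstar)
    (U : (bg9Y (Matrix (Fin N) (Fin N) ℂ) (specialUnitaryUnits (Fin N)) x).Cfg) (y y' : (geo9Y x).Site) :
    (opsYOfRecordV4E N θ Mstar 𝔯 (sectEY_flat N θ Mstar) 𝔴 𝔈 x).Ck.ker U y y' = 0 :=
  operatorLayerYSectE_Ck_ker_flat x (opsYS349OfRecordV4 N θ Mstar 𝔯 𝔈 x) (lettersYOfRecordV4 N θ Mstar 𝔯 x) (𝔴 x) U y y'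

/-- ★ **ROW 24 (`t315`) AT THE v4 INSTANCE OF RECORD, UNFOLDED** (`Iff.rfl`) — the NAMED binder the N06 certificate displays for row 24 at v4.
[cite: Balaban1985BackgroundPropagators, Thm 3.15 (3.185)–(3.187) p.432] -/
theorem t315_opsYOfRecordV4E_iff :
    B9.Thm315FullPrinted c35Y geo9Y (bg9Y (Matrix (Fin N) (Fin N) ℂ) (specialUnitaryUnits (Fin N)))
        (fun x => (opsYOfRecordV4E N θ Mstar 𝔯 𝔢 𝔴 𝔈 x).Ck) inΛY unitDistY
        (fun x => (opsYOfRecordV4E N θ Mstar 𝔯 𝔢 𝔴 𝔈 x).GivenBy3185) (fun x => (opsYOfRecordV4E N θ Mstar 𝔯 𝔢 𝔴 𝔈 x).HasRWExpC) ↔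
      B9.Thm315FullPrinted c35Y geo9Y (bg9Y (Matrix (Fin N) (Fin N) ℂ) (specialUnitaryUnits (Fin N)))
        (fun x => siteKernelOfOp x.toKIdx (bg9Y (Matrix (Fin N) (Fin N) ℂ) (specialUnitaryUnits (Fin N)) x) (fun U => U)
          (CkY x (lettersYOfRecordV4 N θ Mstar 𝔯 x) (𝔢 x)) id id) inΛY unitDistY
        (fun x => givenBy3185Y x (lettersYOfRecordV4 N θ Mstar 𝔯 x) (𝔢 x)) (fun x => hasRWExpCY (𝔴 x)) := Iff.rfl

/-- THE HONESTY GUARD at v4: at the FLAT Sect. E letters and the FLAT walk letters row 24 holds OUTRIGHT (content enters exactly with genuine letters).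
[cite: Balaban1985BackgroundPropagators, Thm 3.15 (3.185)–(3.187) p.432, bookkeeping] -/
theorem t315_opsYOfRecordV4E_flat {δ₀ : ℝ} (hδ₀ : 0 < δ₀) :
    B9.Thm315FullPrinted c35Y geo9Y (bg9Y (Matrix (Fin N) (Fin N) ℂ) (specialUnitaryUnits (Fin N)))
      (fun x => (opsYOfRecordV4E N θ Mstar 𝔯 (sectEY_flat N θ Mstar) (rwEY_flat N θ Mstar) 𝔈 x).Ck) inΛY unitDistY
      (fun x => (opsYOfRecordV4E N θ Mstar 𝔯 (sectEY_flat N θ Mstar) (rwEY_flat N θ Mstar) 𝔈 x).GivenBy3185)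
      (fun x => (opsYOfRecordV4E N θ Mstar 𝔯 (sectEY_flat N θ Mstar) (rwEY_flat N θ Mstar) 𝔈 x).HasRWExpC) :=
  ⟨δ₀, 1, 1, hδ₀, one_pos, one_pos, fun x _ _ _ U _ _ =>
    ⟨givenBy3185Y_flat x _ U, hasRWExpCY_flat _ _ x U δ₀, fun y y' _ _ => by
      rw [opsYOfRecordV4E_Ck_ker_flat, abs_zero]
      exact mul_nonneg zero_le_one (Real.exp_nonneg _)⟩⟩

/-- ★★ **THE v4 LETTERS OF RECORD ARE GAUGE COVARIANT** at every member, for a covariant residual family (Sect. D∕E letters).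
[cite: Balaban1985BackgroundPropagators, (3.33)–(3.34) p.396, (3.119)–(3.153) pp.419–426, Thm 3.14 pp.426–427] -/
theorem lettersYOfRecordV4_cov (x : MemberY θ.d₆ θ.ℓ₆ θ.hd' θ.hL' θ.b₀ θ.b₁ Mstar) (hΔ : IsCovBondOpY x.toKIdx (𝔯 x).Δ2)
    (g : GaugeY (Matrix (Fin N) (Fin N) ℂ) x.toKIdx) (U : CfgY (Matrix (Fin N) (Fin N) ℂ) x.toKIdx) :
    Intw (conjY (gBondY x.toKIdx g)) (conjY (gBondY x.toKIdx g)) ((lettersYOfRecordV4 N θ Mstar 𝔯 x).GD U)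
        ((lettersYOfRecordV4 N θ Mstar 𝔯 x).GD (gaugeY x.toKIdx g U)) ∧
      Intw (conjY (gBondY x.toKIdx g)) (conjY (gBondY x.toKIdx g)) ((lettersYOfRecordV4 N θ Mstar 𝔯 x).G₁ U)
        ((lettersYOfRecordV4 N θ Mstar 𝔯 x).G₁ (gaugeY x.toKIdx g U)) ∧
      Intw (conjY (gBondY x.toKIdx g)) (conjY (gBondY x.toKIdx g)) ((lettersYOfRecordV4 N θ Mstar 𝔯 x).GG U)
        ((lettersYOfRecordV4 N θ Mstar 𝔯 x).GG (gaugeY x.toKIdx g U)) ∧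
      Intw (conjY (gBondY x.toKIdx g)) (conjY (gBondY x.toKIdx g)) ((lettersYOfRecordV4 N θ Mstar 𝔯 x).Kdiff U)
        ((lettersYOfRecordV4 N θ Mstar 𝔯 x).Kdiff (gaugeY x.toKIdx g U)) ∧
      Intw (conjY (gIBondY x.toKIdx g)) (conjY (gBondY x.toKIdx g)) ((lettersYOfRecordV4 N θ Mstar 𝔯 x).H U)
        ((lettersYOfRecordV4 N θ Mstar 𝔯 x).H (gaugeY x.toKIdx g U)) ∧
      Intw (conjY (gIBondY x.toKIdx g)) (conjY (gBondY x.toKIdx g)) ((lettersYOfRecordV4 N θ Mstar 𝔯 x).H₁ U)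
        ((lettersYOfRecordV4 N θ Mstar 𝔯 x).H₁ (gaugeY x.toKIdx g U)) ∧
      Intw (conjY (gIBondY x.toKIdx g)) (conjY (gIBondY x.toKIdx g)) ((lettersYOfRecordV4 N θ Mstar 𝔯 x).QGQinv U)
        ((lettersYOfRecordV4 N θ Mstar 𝔯 x).QGQinv (gaugeY x.toKIdx g U)) ∧
      Intw (conjY (gIBondY x.toKIdx g)) (conjY (gIBondY x.toKIdx g)) ((lettersYOfRecordV4 N θ Mstar 𝔯 x).QG1Qinv U)
        ((lettersYOfRecordV4 N θ Mstar 𝔯 x).QG1Qinv (gaugeY x.toKIdx g U)) :=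
  covLettersY_v4_cov g U (𝔯 x) hΔ

/-- ★★ … and so are its Sect. B letters, with both transporters obeying the contour law.
[cite: Balaban1985BackgroundPropagators, (3.28) p.395, (3.33)–(3.34) p.396] -/
theorem lettersYOfRecordV4_sectB_cov (x : MemberY θ.d₆ θ.ℓ₆ θ.hd' θ.hL' θ.b₀ θ.b₁ Mstar)
    (g : GaugeY (Matrix (Fin N) (Fin N) ℂ) x.toKIdx) (U : CfgY (Matrix (Fin N) (Fin N) ℂ) x.toKIdx) :
    Intw (conjY (gBondY x.toKIdx g)) (conjY (gBondY x.toKIdx g)) ((lettersYOfRecordV4 N θ Mstar 𝔯 x).GA U)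
        ((lettersYOfRecordV4 N θ Mstar 𝔯 x).GA (gaugeY x.toKIdx g U)) ∧
      Intw (conjY (gBlkY x.toKIdx g)) (conjY (gBlkY x.toKIdx g)) ((lettersYOfRecordV4 N θ Mstar 𝔯 x).C U)
        ((lettersYOfRecordV4 N θ Mstar 𝔯 x).C (gaugeY x.toKIdx g U)) ∧
      Intw (conjY (gSiteY x.toKIdx g)) (conjY (gSiteY x.toKIdx g)) ((lettersYOfRecordV4 N θ Mstar 𝔯 x).Gp U)
        ((lettersYOfRecordV4 N θ Mstar 𝔯 x).Gp (gaugeY x.toKIdx g U)) ∧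
      IsGaugeLawS x.toKIdx (lettersYOfRecordV4 N θ Mstar 𝔯 x).parS ∧ IsGaugeLawB x.toKIdx (lettersYOfRecordV4 N θ Mstar 𝔯 x).parB :=
  ⟨covLettersY_v2S_GA_cov g U, covLettersY_v2S_C_cov g U, covLettersY_v2S_Gp_cov g U, parSymY_isGaugeLawS x.toKIdx, parBY_isGaugeLawB x.toKIdx⟩

end Record

end

end Literature.MathematicalPhysics.QuantumFieldTheory.Balaban1983to89.Node00
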